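import Literature.AnabelianGeometry.EtaleTheta.Discharge.Sec3Cor38StdIsoNotGL
import Literature.AlgebraicGeometry.Frobenioids.ModelFrobenioidNoAnchors
import Literature.AnabelianGeometry.EtaleTheta.TemperedFrobenioidToyGenuine
import HarnessLib

/-!
# [EtTh] Cor 3.8, proof l.1–2 (row C38-L01): "`C₁`, `C₂` are of standard and isotropic type, but not of
# group-like type" — UNCONDITIONAL at the canonical monoid vocabulary (the residual `hBmon` removed)

S. Mochizuki, *The étale theta function …*, Publ. RIMS **45** (2009) [MochizukiEtTh2009], Cor. 3.8, proof,
PDF p.81 l.1–2 (printed 307): "First, we recall that by Theorem 3.7, (i), (ii), `C₁`, `C₂` are of standard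
and isotropic type, but not of group-like type"; Thm. 3.7 (i)/(ii), PDF p.79; S. Mochizuki, *The geometry of
Frobenioids I* [MochizukiFrdI2008], Thm. 5.2 (iii) p.101, Rmk. 3.1.1 p.57, Prop. 1.10 (iv) p.37.

PROOF-ONLY companion (abc-iut cell, block F fact-proving wave, seat abc-iut-f-132; FACT-LIST row F-2808
`Cor38Hyp.StandardIsotropicNotGroupLike`, [EtTh] Cor 3.8 p.81) of abc-iut-w5-d124's sub-DAG statements file
`TemperedFrobenioidCor38Sub.lean` (row C38-L01 := `PreFrobenioidData.Thm42Setting C₁.opsData C₂.opsData`) and of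
abc-iut-w5-d135's `Discharge/Sec3Cor38StdIsoNotGL.lean`, which discharged the row at the canonical vocabularies
MODULO the standing residual of the L2 board `hBmon_i : IsMonoidOn C_i.ratFnFunctor` ("`B` a monoid on `D`",
[FrdI] Thm 5.2 preamble) — entering only through the clause "of standard type", proved there from L1's
`ModelFrobenioid.standardTypeIff_holds` under the full bundle `ModelFrobenioid.Hypotheses`.

THIS FILE removes that residual.  abc-iut-w4-d084's `ModelFrobenioid.data_isOfStandardType_of`
(`Frobenioids/ModelFrobenioidNoAnchors.lean`: a model Frobenioid has NO anchors, hence is of quasi-isotropic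
type, as soon as the `Φ(A)` are SHARP, `B` is group-like and `D` is totally epimorphic — [FrdI] Thm 5.2 (iii)
right-to-left WITHOUT the "monoid on `D`" hypotheses) applies to every tempered Frobenioid `C` of Def. 3.6 (ii):
* `B = B₀^Λ|_D ×_{(Φ^{ℝ-log})^gp} Φ^gp` is group-like (`RealifiedDivisorMonoids.isUnit_BΛ`; L6-t13's
  `ratFnFunctor_isGroupLike_holds`);
* `D` is totally epimorphic (field `isTotallyEpimorphic` of Def. 3.6 (ii));
* `Φ` is not the zero monoid (Def. 3.6 (ii)(b), `not_isZeroMonoid_divisorMonoid`), so condition (a) of [FrdI]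
  Thm 5.2 (iii) is vacuous;
* the `Φ(A)` are SHARP whenever "perf-factorial" is READ in the tree ([FrdI] Def 2.4 (i): perf-factorial ⟹
  divisorial ⟹ sharp, `IsPerfFactorial.isDivisorial`, `IsDivisorial.isSharp`) — i.e. over the canonical monoid
  vocabulary `treeMonoidVocab` (any category vocabulary `VD`), field `isPerfFactorial` of Def. 3.6 (ii); or,
  over any monoid vocabulary, whenever "divisorial monoid on `D`" is read in the tree (`treeCatVocab`,
  `isDivisorial_divisorMonoid`).
Hence:
* `TemperedFrobenioid.opsData_isOfStandardType_of_isSharp` — Thm 3.7 (ii), first clause, for ANY vocabularies,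
  from sharp `Φ(A)`, `D` of FSMFF-type, `Φ` non-dilating (no `hBmon`, no `ModelFrobenioid.Hypotheses`), and the
  equivalence form `opsData_isOfStandardType_iff_of_isSharp` (Thm 5.2 (iii) is an iff);
* `TemperedFrobenioid.opsData_isOfStandardType_treeMonoidVocab'` / `…_treeCatVocab'` — the same with sharpness
  discharged by the fields of Def. 3.6 (ii);
* **`Cor38Hyp.standardIsotropicNotGroupLike_treeMonoidVocab (h : Cor38Hyp C₁ C₂) : h.StandardIsotropicNotGroupLike`
  — row C38-L01 with NO binder**, for every pair of tempered Frobenioids over the canonical monoid vocabulary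
  and arbitrary category vocabularies ("`D_i` of FSMFF-type", "`Φ_i` non-dilating" ARE the fields `h.fsmff`,
  `h.nonDilating` of the Cor. 3.8 data); the symmetric setting `thm42Setting_symm_treeMonoidVocab`; and the
  hBmon-free form at w5-d135's vocabulary pair, `standardIsotropicNotGroupLike_treeCatVocab'` (same binders as
  their `standardIsotropicNotGroupLike_treeCatVocab` minus `hBmon₁ hBmon₂` — consumers swap the name);
* closed instance: `Toy.standardIsotropicNotGroupLike_genuine` at abc-iut-w5-d164's constructed, Frobenioid-
  certified `Toy.genuineTemperedFrobenioid` (whose `Cor38Hyp` is inhabited, `Toy.nonempty_cor38Hyp_genuine`), and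
  `Toy.exists_cor38Hyp_standardIsotropicNotGroupLike_genuine`.
So the binder lists of the Cor. 3.8 (i)/(ii) knits (`cor38_i_of_rows`, `cor38_ii_of_rows`, `Sec3Cor38iAssembly`,
`Sec3Cor38Thm34RowsTreeVocab`) lose C38-L01 OUTRIGHT (not in favour of `hBmon`).  FACT-LIST reading (R5): the
row is a schema over the free vocabulary stubs `V`, `VD`; its instance form at the canonical vocabulary — the one
print means — is PROVED here for all data.

HONEST FRAMING: refereed pre-IUT material ([EtTh] §3 over [FrdI] §3/§5); nothing here bears on [IUTchIII]
Cor. 3.12; no statement of either paper is strengthened in its conclusion; typed ≠ proved — here PROVED.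
-/

namespace Literature.AnabelianGeometry.EtaleTheta

open CategoryTheory Opposite Literature.AlgebraicGeometry.Frobenioids

universe u₀ v₀ u v w

namespace TemperedFrobenioid

/-! ## Over arbitrary vocabularies: sharp `Φ(A)` suffices -/

section General

variable {D₀ : Type u₀} [Category.{v₀} D₀] {V : FrdIMonoidStub.{w}}
  {T : RealifiedDivisorMonoids (D₀ := D₀) V} {D : Type u} [Category.{v} D]
  {VD : FrdICatStub.{u, v, w} D} (C : TemperedFrobenioid T D VD)

/-- **Thm 3.7 (ii), first clause, WITHOUT the "monoid on `D`" hypotheses** ("Suppose `D` is of FSMFF-type,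
and that `Φ` is non-dilating. Then `C` is of standard type", p.79; "follows immediately from [Mzk17], Theorem
5.2, (iii)", p.80): for a tempered Frobenioid whose divisor monoids `Φ(A)` are SHARP, `D` of FSMFF-type and `Φ`
non-dilating imply that the model Frobenioid `C` is of standard type ([FrdI] Def 3.1 (i)) — via abc-iut-w4-d084's
no-anchors form of [FrdI] Thm 5.2 (iii) (`ModelFrobenioid.data_isOfStandardType_of`): `B` is group-like
(`isUnit_BΛ`), `D` is totally epimorphic, and condition (a) is vacuous since `Φ ≠ 0` (Def. 3.6 (ii)(b)).
[cite: MochizukiEtTh2009, Thm 3.7 (ii) p.79] -/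
theorem opsData_isOfStandardType_of_isSharp (hΦs : ∀ A : Dᵒᵖ, IsSharp (C.Φ.carrier A))
    (hD : IsOfFSMFFType D) (hnd : IsNonDilatingOn C.divisorMonoid) : C.opsData.IsOfStandardType :=
  ModelFrobenioid.data_isOfStandardType_of C.divisorMonoid C.ratFnFunctor C.divBNatTrans
    C.ratFnFunctor_isGroupLike_holds (fun A => hΦs (op A)) C.isTotallyEpimorphic
    (fun h0 => absurd h0 C.not_isZeroMonoid_divisorMonoid) hD hnd

/-- … and the equivalence form ([FrdI] Thm 5.2 (iii), first sentence, is an "if and only if"): for sharp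
`Φ(A)`, `C` is of standard type iff `D` is of FSMFF-type and `Φ` is non-dilating.
[cite: MochizukiEtTh2009, Thm 3.7 (ii) p.79] -/
theorem opsData_isOfStandardType_iff_of_isSharp (hΦs : ∀ A : Dᵒᵖ, IsSharp (C.Φ.carrier A)) :
    C.opsData.IsOfStandardType ↔ IsOfFSMFFType D ∧ IsNonDilatingOn C.divisorMonoid := by
  refine ⟨fun hs => ?_, fun h => C.opsData_isOfStandardType_of_isSharp hΦs h.1 h.2⟩
  have h := (ModelFrobenioid.data_isOfStandardType_iff C.divisorMonoid C.ratFnFunctor C.divBNatTrans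
    C.ratFnFunctor_isGroupLike_holds (fun A => hΦs (op A)) C.isTotallyEpimorphic).mp hs
  exact ⟨h.2.1, h.2.2⟩

/-- **The whole [FrdI] Thm 4.2 setting for ONE tempered Frobenioid with sharp divisor monoids**: standard
(Thm 3.7 (ii)), isotropic and not group-like (Thm 3.7 (i), unconditional: w5-d135's
`opsData_isOfIsotropicType`, `opsData_not_isOfGroupLikeType`). [cite: MochizukiEtTh2009, Thm 3.7 p.79] -/
theorem thm42Setting_self_of_isSharp (hΦs : ∀ A : Dᵒᵖ, IsSharp (C.Φ.carrier A)) (hD : IsOfFSMFFType D)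
    (hnd : IsNonDilatingOn C.divisorMonoid) : PreFrobenioidData.Thm42Setting C.opsData C.opsData :=
  ⟨⟨C.opsData_isOfStandardType_of_isSharp hΦs hD hnd, C.opsData_isOfStandardType_of_isSharp hΦs hD hnd⟩,
    ⟨C.opsData_isOfIsotropicType, C.opsData_isOfIsotropicType⟩,
    ⟨C.opsData_not_isOfGroupLikeType, C.opsData_not_isOfGroupLikeType⟩⟩

end General

/-! ## At the canonical category vocabulary `treeCatVocab` (any monoid vocabulary): sharp from "divisorial" -/

section TreeCatVocab

variable {D₀ : Type u₀} [Category.{v₀} D₀] {V : FrdIMonoidStub.{w}}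
  {T : RealifiedDivisorMonoids (D₀ := D₀) V} {D : Type u} [Category.{v} D]
  {IsRational IsStrictlyRational : (Dᵒᵖ ⥤ CommMonCat.{w}) → Prop}
  (C : TemperedFrobenioid T D (treeCatVocab D IsRational IsStrictlyRational))

/-- At the canonical category vocabulary the divisor monoids `Φ(A)` are sharp ("divisorial monoid on `D`"
read in the tree: [FrdI] Def 1.1 (i), divisorial ⟹ sharp). [cite: MochizukiEtTh2009, Def 3.6 p.77] -/
theorem isSharp_carrier_treeCatVocab (A : Dᵒᵖ) : IsSharp (C.Φ.carrier A) :=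
  (C.isDivisorial_divisorMonoid (unop A)).isSharp

/-- **Thm 3.7 (ii), first clause, at `treeCatVocab` WITHOUT `hBmon`** (supersedes `isOfStandardType_treeCatVocab
(hBmon) (hD) (hnd)` of `Sec3Thm37Standard`): `D` of FSMFF-type and `Φ` non-dilating ⟹ `C` of standard type.
[cite: MochizukiEtTh2009, Thm 3.7 (ii) p.79] -/
theorem opsData_isOfStandardType_treeCatVocab' (hD : IsOfFSMFFType D) (hnd : IsNonDilatingOn C.divisorMonoid) :
    C.opsData.IsOfStandardType :=
  C.opsData_isOfStandardType_of_isSharp C.isSharp_carrier_treeCatVocab hD hnd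

/-- … and the equivalence form at `treeCatVocab`, without `hBmon`. [cite: MochizukiEtTh2009, Thm 3.7 (ii) p.79] -/
theorem opsData_isOfStandardType_treeCatVocab_iff' :
    C.opsData.IsOfStandardType ↔ IsOfFSMFFType D ∧ IsNonDilatingOn C.divisorMonoid :=
  C.opsData_isOfStandardType_iff_of_isSharp C.isSharp_carrier_treeCatVocab

end TreeCatVocab

/-! ## At the canonical monoid vocabulary `treeMonoidVocab` (any category vocabulary): sharp from "perf-factorial" -/

section TreeMonoidVocab

variable {D₀ : Type u₀} [Category.{v₀} D₀] {T : RealifiedDivisorMonoids (D₀ := D₀) treeMonoidVocab.{w}}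
  {D : Type u} [Category.{v} D] {VD : FrdICatStub.{u, v, w} D} (C : TemperedFrobenioid T D VD)

/-- At the canonical monoid vocabulary the divisor monoids `Φ(A)` are sharp: "`Φ` … determines a
perf-factorial … monoid" (Def. 3.6 (ii)) read in the tree — [FrdI] Def 2.4 (i) perf-factorial ⟹ divisorial ⟹
sharp. [cite: MochizukiEtTh2009, Def 3.6 p.77] -/
theorem isSharp_carrier_treeMonoidVocab (A : Dᵒᵖ) : IsSharp (C.Φ.carrier A) :=
  ((treeMonoidVocab_isPerfFactorial _).mp (C.isPerfFactorial A)).isDivisorial.isSharp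

/-- **Thm 3.7 (ii), first clause, at `treeMonoidVocab` with NO residual**: `D` of FSMFF-type and `Φ`
non-dilating ⟹ `C` of standard type, for every tempered Frobenioid over the canonical monoid vocabulary.
[cite: MochizukiEtTh2009, Thm 3.7 (ii) p.79] -/
theorem opsData_isOfStandardType_treeMonoidVocab' (hD : IsOfFSMFFType D)
    (hnd : IsNonDilatingOn C.divisorMonoid) : C.opsData.IsOfStandardType :=
  C.opsData_isOfStandardType_of_isSharp C.isSharp_carrier_treeMonoidVocab hD hnd

/-- **Thm 3.7 (ii), first clause, at `treeMonoidVocab`, non-dilating hypothesis in the shape of the Cor. 3.8 data**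
(`∀ (A : Dᵒᵖ) (f : A ⟶ A), V.IsNonDilating (Φ(A)) (Φ.pull f)`, which at the canonical monoid vocabulary IS the
tree's `IsNonDilatingOn Φ`, `isNonDilatingOn_divisorMonoid_iff`) — any category vocabulary, no residual.
[cite: MochizukiEtTh2009, Thm 3.7 (ii) p.79] -/
theorem opsData_isOfStandardType_treeMonoidVocab_of_forall_pull (hD : IsOfFSMFFType D)
    (hnd : ∀ (A : Dᵒᵖ) (f : A ⟶ A), treeMonoidVocab.{w}.IsNonDilating (C.Φ.carrier A) (C.Φ.pull f)) :
    C.opsData.IsOfStandardType :=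
  C.opsData_isOfStandardType_treeMonoidVocab' hD
    (C.isNonDilatingOn_divisorMonoid_iff.2 fun A f => (treeMonoidVocab_isNonDilating _ _).mp (hnd A f))

/-- … and the equivalence form at `treeMonoidVocab` (Thm 3.7 (ii)'s hypotheses are also necessary).
[cite: MochizukiEtTh2009, Thm 3.7 (ii) p.79] -/
theorem opsData_isOfStandardType_treeMonoidVocab_iff' :
    C.opsData.IsOfStandardType ↔ IsOfFSMFFType D ∧ IsNonDilatingOn C.divisorMonoid :=
  C.opsData_isOfStandardType_iff_of_isSharp C.isSharp_carrier_treeMonoidVocab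

end TreeMonoidVocab

end TemperedFrobenioid

/-! ## Row C38-L01 with NO binder -/

namespace Cor38Hyp

section TreeMonoidVocab

variable {D₀ : Type u₀} [Category.{v₀} D₀] {D₀' : Type u₀} [Category.{v₀} D₀']
  {T : RealifiedDivisorMonoids (D₀ := D₀) treeMonoidVocab.{w}}
  {T' : RealifiedDivisorMonoids (D₀ := D₀') treeMonoidVocab.{w}}
  {D : Type u} [Category.{v} D] {D' : Type u} [Category.{v} D']
  {VD : FrdICatStub.{u, v, w} D} {VD' : FrdICatStub.{u, v, w} D'}
  {C₁ : TemperedFrobenioid T D VD} {C₂ : TemperedFrobenioid T' D' VD'}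

/-- **C38-L01 — "by Theorem 3.7, (i), (ii), `C₁`, `C₂` are of standard and isotropic type, but not of group-like
type" — PROVED with NO residual** for every pair of tempered Frobenioids over the canonical monoid vocabulary
(arbitrary category vocabularies): the [FrdI] Thm 4.2 setting `StandardIsotropicNotGroupLike h` holds for every
`h : Cor38Hyp C₁ C₂` ("`D_i` of FSMFF-type", "`Φ_i` non-dilating" are its fields `h.fsmff`, `h.nonDilating`).
[cite: MochizukiEtTh2009, Cor 3.8 p.81] -/
theorem standardIsotropicNotGroupLike_treeMonoidVocab (h : Cor38Hyp C₁ C₂) : h.StandardIsotropicNotGroupLike :=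
  ⟨⟨C₁.opsData_isOfStandardType_treeMonoidVocab_of_forall_pull h.fsmff.1 h.nonDilating.1,
      C₂.opsData_isOfStandardType_treeMonoidVocab_of_forall_pull h.fsmff.2 h.nonDilating.2⟩,
    ⟨C₁.opsData_isOfIsotropicType, C₂.opsData_isOfIsotropicType⟩,
    ⟨C₁.opsData_not_isOfGroupLikeType, C₂.opsData_not_isOfGroupLikeType⟩⟩

/-- The symmetric setting (for the `Ψ⁻¹`-directions of the knits), with no residual.
[cite: MochizukiEtTh2009, Cor 3.8 p.81] -/
theorem thm42Setting_symm_treeMonoidVocab (h : Cor38Hyp C₁ C₂) :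
    PreFrobenioidData.Thm42Setting C₂.opsData C₁.opsData :=
  h.standardIsotropicNotGroupLike_symm h.standardIsotropicNotGroupLike_treeMonoidVocab

/-- **The universal closure of row C38-L01 over the canonical monoid vocabulary HOLDS** (all base data, all
category vocabularies, all Cor. 3.8 data). [cite: MochizukiEtTh2009, Cor 3.8 p.81] -/
theorem forall_standardIsotropicNotGroupLike_treeMonoidVocab :
    ∀ (D₀ : Type u₀) (_ : Category.{v₀} D₀) (D₀' : Type u₀) (_ : Category.{v₀} D₀')
      (T : RealifiedDivisorMonoids (D₀ := D₀) treeMonoidVocab.{w})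
      (T' : RealifiedDivisorMonoids (D₀ := D₀') treeMonoidVocab.{w})
      (D : Type u) (_ : Category.{v} D) (D' : Type u) (_ : Category.{v} D')
      (VD : FrdICatStub.{u, v, w} D) (VD' : FrdICatStub.{u, v, w} D')
      (C₁ : TemperedFrobenioid T D VD) (C₂ : TemperedFrobenioid T' D' VD') (h : Cor38Hyp C₁ C₂),
      h.StandardIsotropicNotGroupLike :=
  fun _ _ _ _ _ _ _ _ _ _ _ _ _ _ h => h.standardIsotropicNotGroupLike_treeMonoidVocab

end TreeMonoidVocab

section TreeCatVocab

variable {D₀ : Type u₀} [Category.{v₀} D₀] {D₀' : Type u₀} [Category.{v₀} D₀'] {V : FrdIMonoidStub.{w}}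
  {T : RealifiedDivisorMonoids (D₀ := D₀) V} {T' : RealifiedDivisorMonoids (D₀ := D₀') V}
  {D : Type u} [Category.{v} D] {D' : Type u} [Category.{v} D']
  {IsRational IsStrictlyRational : (Dᵒᵖ ⥤ CommMonCat.{w}) → Prop}
  {IsRational' IsStrictlyRational' : (D'ᵒᵖ ⥤ CommMonCat.{w}) → Prop}
  {C₁ : TemperedFrobenioid T D (treeCatVocab D IsRational IsStrictlyRational)}
  {C₂ : TemperedFrobenioid T' D' (treeCatVocab D' IsRational' IsStrictlyRational')}

/-- **C38-L01 at the canonical category vocabulary over ANY monoid vocabulary, WITHOUT `hBmon`**, given the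
tree-shape non-dilating hypotheses (over a free monoid vocabulary `V` the field `h.nonDilating` is a stub
predicate and cannot be read). [cite: MochizukiEtTh2009, Cor 3.8 p.81] -/
theorem standardIsotropicNotGroupLike_treeCatVocab_of_isNonDilatingOn (h : Cor38Hyp C₁ C₂)
    (hnd₁ : IsNonDilatingOn C₁.divisorMonoid) (hnd₂ : IsNonDilatingOn C₂.divisorMonoid) :
    h.StandardIsotropicNotGroupLike :=
  ⟨⟨C₁.opsData_isOfStandardType_treeCatVocab' h.fsmff.1 hnd₁,
      C₂.opsData_isOfStandardType_treeCatVocab' h.fsmff.2 hnd₂⟩,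
    ⟨C₁.opsData_isOfIsotropicType, C₂.opsData_isOfIsotropicType⟩,
    ⟨C₁.opsData_not_isOfGroupLikeType, C₂.opsData_not_isOfGroupLikeType⟩⟩

end TreeCatVocab

section BothVocab

variable {D₀ : Type u₀} [Category.{v₀} D₀] {D₀' : Type u₀} [Category.{v₀} D₀']
  {T : RealifiedDivisorMonoids (D₀ := D₀) treeMonoidVocab.{w}}
  {T' : RealifiedDivisorMonoids (D₀ := D₀') treeMonoidVocab.{w}}
  {D : Type u} [Category.{v} D] {D' : Type u} [Category.{v} D']
  {IsRational IsStrictlyRational : (Dᵒᵖ ⥤ CommMonCat.{w}) → Prop}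
  {IsRational' IsStrictlyRational' : (D'ᵒᵖ ⥤ CommMonCat.{w}) → Prop}
  {C₁ : TemperedFrobenioid T D (treeCatVocab D IsRational IsStrictlyRational)}
  {C₂ : TemperedFrobenioid T' D' (treeCatVocab D' IsRational' IsStrictlyRational')}

/-- **C38-L01 at abc-iut-w5-d135's vocabulary pair with NO residual**: same binders as their
`standardIsotropicNotGroupLike_treeCatVocab` minus `hBmon₁ hBmon₂` — consumers of that name may swap to this
one and drop the two hypotheses. [cite: MochizukiEtTh2009, Cor 3.8 p.81] -/
theorem standardIsotropicNotGroupLike_treeCatVocab' (h : Cor38Hyp C₁ C₂) : h.StandardIsotropicNotGroupLike :=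
  h.standardIsotropicNotGroupLike_treeMonoidVocab

/-- … and the symmetric setting there, with no residual. [cite: MochizukiEtTh2009, Cor 3.8 p.81] -/
theorem thm42Setting_symm_treeCatVocab' (h : Cor38Hyp C₁ C₂) :
    PreFrobenioidData.Thm42Setting C₂.opsData C₁.opsData :=
  h.thm42Setting_symm_treeMonoidVocab

end BothVocab

end Cor38Hyp

/-! ## Closed instance: the genuine-vocabulary toy tempered Frobenioid -/

namespace Toy

variable (R S : ((Discrete PUnit.{1})ᵒᵖ ⥤ CommMonCat.{0}) → Prop)

/-- **Row C38-L01 at a CONSTRUCTED tempered Frobenioid**: for abc-iut-w5-d164's Frobenioid-certified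
`Toy.genuineTemperedFrobenioid R S` (genuine vocabularies, constructed realification) and EVERY Cor. 3.8 datum
`h` on it, `StandardIsotropicNotGroupLike h` holds — a closed instance of the row (degenerate geometry; a
consistency witness only). [cite: MochizukiEtTh2009, Cor 3.8 p.81] -/
theorem standardIsotropicNotGroupLike_genuine
    (h : Cor38Hyp (genuineTemperedFrobenioid R S) (genuineTemperedFrobenioid R S)) :
    h.StandardIsotropicNotGroupLike :=
  h.standardIsotropicNotGroupLike_treeMonoidVocab

/-- … and the row is NON-VACUOUSLY instantiated: some Cor. 3.8 datum on the genuine toy exists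
(`Toy.nonempty_cor38Hyp_genuine`: `Ψ := 𝟭`) and satisfies C38-L01. [cite: MochizukiEtTh2009, Cor 3.8 p.81] -/
theorem exists_cor38Hyp_standardIsotropicNotGroupLike_genuine :
    ∃ h : Cor38Hyp (genuineTemperedFrobenioid R S) (genuineTemperedFrobenioid R S),
      h.StandardIsotropicNotGroupLike :=
  (nonempty_cor38Hyp_genuine R S).elim fun h => ⟨h, standardIsotropicNotGroupLike_genuine R S h⟩

/-- The model Frobenioid of the genuine toy is of standard type ([FrdI] Def 3.1 (i)) — Thm 3.7 (ii) at a
constructed datum, no binder. [cite: MochizukiEtTh2009, Thm 3.7 (ii) p.79] -/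
theorem opsData_isOfStandardType_genuine : (genuineTemperedFrobenioid R S).opsData.IsOfStandardType :=
  ((nonempty_cor38Hyp_genuine R S).elim
    fun h => (standardIsotropicNotGroupLike_genuine R S h).standard.1 :)

end Toy

end Literature.AnabelianGeometry.EtaleTheta
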